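/-
Copyright (c) 2026 the pub-hodgecm-mathlib formalisation cell (harness21).  Prover seat hodgecm-mathlib-A-p03 (g26); road «R1LL-tree» (architect A-p16 (g27), RULINGS A-16 (b) ∕ A-18 (a);
LEAD F0P3a-plan (g10)), brick I-5a-ram FILE D «compact elements of `U(Φ₂)` at a tamely ramified place fix a self-dual or an `η`-modular lattice», 2026-09-01.
-/
import Literature.NumberTheory.Automorphic.UnitaryCompactElementVertexLatticeRamifiedFrames   -- ★ I-5a-ram FILE C (this seat): the ramified frames
import Literature.NumberTheory.Automorphic.HermitianLatticeTreeTransitiveRamifiedFlags      -- ★ A-p06 (g27): (hB) `forall_isModularLattice_exists_latt_mul_eq_of_ramified` (+ ★ (hA) ramified)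
import Literature.NumberTheory.Automorphic.RamifiedPlaceAntiFixedUniformizer               -- ★ F0P3a-p04 (g13): `odd_log_valued_of_galAdicCompletionMap_eq_neg` (anti-fixed ⇒ odd valuation)
import HarnessLib

/-!
# Compact elements of `U(Φ₂)(L⁺_v)` at a TAMELY RAMIFIED place fix a self-dual lattice (an EDGE of the tree of `U`) or an `η`-modular lattice (a VERTEX)

Ramified twin of ★ `UnitaryCompactElementVertexLattice` (g25, inert).  `L` CM, `v` a finite place of `L⁺` RAMIFIED in `L` (`e(w|v) ≠ 1`) with `w ∣ v` non-split
(`w̄ = w`), TAME (`|2|_w = 1`), `σ_w = galAdicCompletionMap (complexConj L) hw`, `η ∈ L_wˣ` an ANTI-FIXED uniformiser (`v_w(η) = exp(−1)`, `σ_w η = −η`,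
★ `exists_uniformizer_galAdicCompletionMap_complexConj_eq_neg_of_ramified`), `(Φ₂)_w = placeForm Φ₂ w = antidiag(1,1)`, `U = U(σ_w, (Φ₂)_w)(L_w)`.
GEOMETRY (MEMO-R1ram §2; B-p12 census (U1); ★ `HermitianLatticeTreeDefs` «at a TAME RAMIFIED place the lattice tree is the BARYCENTRIC SUBDIVISION of the tree of `U`»):
the special lattices are SELF-DUAL (`Λ(g) = g𝒪²`, `ᵗσ(g)(Φ₂)_w g ∈ GL₂(𝒪_w)`; stabiliser of `𝒪²` = `K = U ∩ GL₂(𝒪_w)` = the stabiliser of an EDGE midpoint: the residual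
form is symmetric hyperbolic, two isotropic lines) and `η`-MODULAR (`ᵗσ(g)(Φ₂)_w g ∈ η·GL₂(𝒪_w)`; reference `Λ₁ = 𝒪 ⊕ η𝒪 = D_η𝒪²`, `D_η = diag(1, η)`; stabiliser
`K♯ = U ∩ D_η GL₂(𝒪_w) D_η⁻¹` = the stabiliser of a VERTEX: the residual form of `η⁻¹h` is symplectic, valency `q+1`).  `D_η` is NOT a similitude of `(Φ₂)_w`
(`ᵗσ(D_η)(Φ₂)_w D_η = η·antidiag(1,−1)`), so — unlike the inert mirror ★ `UnitaryGroupModularLocusCM` — `K♯` is not a conjugate of `K`; the `η`-modular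
transitivity is Bruhat–Tits flag transitivity ★ `forall_isModularLattice_exists_latt_mul_eq_of_ramified` (A-p06).

* §1 `even_log_valued_of_galAdicCompletionMap_eq` — `σ_w`-FIXED non-zero elements have EVEN valuation (from ★ anti-fixed ⇒ odd, applied to `y·η`); hence every
  `σ_w`-fixed `a ≠ 0` rescales to a unit `σ_w(c)·a·c`, `c = η^j` (`exists_valuation_map_mul_mul_eq_one_of_galAdicCompletionMap_eq`).
* §2 HEAD **`exists_vertexFrame_of_trace_mem_of_ramified`**: every `γ ∈ U` with `tr γ ∈ 𝒪_w` admits `g ∈ GL₂(L_w)`, `e ∈ {0,1}`, `J′ ∈ GL₂(𝒪_w)` with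
  `η^e • ↑J′ = ᵗσ_w(g) (Φ₂)_w g` and `g⁻¹γg ∈ GL₂(𝒪_w)` — g25's trichotomy of `χ_γ` over `L_w`: type (1) elliptic ⇒ `e = 0` (★ FILE C §4 with §1), split torus ⇒ `e = 0`
  (★ FILE A), double root ⇒ `e = 0` (★ FILE C §3), rootless ⇒ `e = ord(γ₁₀) mod 2` (★ FILE C §1–§2).
* §3 the two colours in group currency: `exists_eq_mul_mul_inv_of_selfDual_antidiagTwo_of_ramified` (`γ = y k y⁻¹`, `k ∈ K`; ★ `…SelfDualLocusRamifiedPlace`),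
  the by-product **`exists_mem_unitaryGroupOfForm_mul_glDiagonal_mul_of_modular_of_ramified`** («every `η`-modular lattice is `u·Λ₁`»: `g = u·D_η·k`; ★ A-p06 (hB))
  and `exists_eq_mul_mul_inv_of_modular_antidiagTwo_of_ramified` (`k ∈ K♯ = ((GL₂(𝒪_w)).map (conj D_η)).subgroupOf U`).
* §4 COVER **`exists_eq_mul_mul_inv_or_of_trace_mem_of_ramified`**: `{γ ∈ U | tr γ ∈ 𝒪_w} ⊆ ⋃_y yKy⁻¹ ∪ ⋃_y yK♯y⁻¹` — the ramified sibling input of the architect's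
  `exists_vertexCover` (I-7b) in g25's two-disjunct shape.

Topic `NumberTheory/Automorphic`; namespace `Literature.NumberTheory.Automorphic.UnitaryGroup`.  THEOREMS ONLY (no definition, no instance, no notation, no named fact,
no `sorry`); kernel lane.  Cell `pub/hodgecm-mathlib`, F0∕P3a, crux H413 (stmt-HodgeConjecture-24833), road «R1LL-tree» ramified branch.  HONEST LABEL: HC_CM is proved
only modulo the printed citations until rung 0 closes — nothing printed is asserted here.

## References
* [BruhatTits1972] F. Bruhat, J. Tits, *Groupes réductifs sur un corps local I*, Publ. IHÉS 41 (1972), §10 (rank one; the barycentric subdivision at a ramified place).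
* [Jacobowitz1962] R. Jacobowitz, *Hermitian forms over local fields*, Amer. J. Math. 84 (1962), §5, §8 (ramified case: `𝔓`-modular lattices).
* [LabesseLanglands1979] J.-P. Labesse, R. P. Langlands, *L-indistinguishability for SL(2)*, Canad. J. Math. 31 (1979), §2 pp. 8–10 (the ramified torus, `δ_m = 2q^m`).
* [Serre1980Trees] J.-P. Serre, *Trees* (1980), Ch. II §1.3 (bounded subgroups fix a vertex).
* [Rogawski1990] J. D. Rogawski, *Automorphic Representations of Unitary Groups in Three Variables* (1990), §3.5–§3.6, §4.9 Lemma 4.9.3 p. 56, §12.6 p. 174.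
-/

set_option autoImplicit false

noncomputable section

open scoped ValuativeRel Matrix MatrixGroups
open Matrix ValuativeRel NumberField IsDedekindDomain
open Literature.AlgebraicGeometry.ShimuraVarieties (unitaryGroup mem_unitaryGroup_iff)
open Literature.NumberTheory.Automorphic.HermitianLatticeTree (latt IsModularLattice forall_isModularLattice_exists_latt_mul_eq_of_ramified
  isUnimodular₂_inv_smul_iff_exists_mem_glInt)

namespace Literature.NumberTheory.Automorphic

namespace UnitaryGroup

open Literature.NumberTheory.Rogawski1990 Literature.NumberTheory.GaloisRepresentations

section CM

variable (L : Type) [Field L] [NumberField L] [IsCMField L] (v : HeightOneSpectrum (𝓞 ↥(maximalRealSubfield L)))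
  (w : PlacesOver L v) (hw : IsCMField.complexConj L • w.1 = w.1)

/-! ## §1 `σ_w`-fixed elements have EVEN valuation at a tamely ramified place -/

include hw in
/-- **`σ_w`-FIXED NON-ZERO ELEMENTS HAVE EVEN VALUATION at a tamely ramified non-split place**: `σ_w y = y ≠ 0 ⇒ v_w(y) = exp(2j)`.  With an anti-fixed uniformiser `η`
(`σ_w η = −η`), `y·η` is anti-fixed, hence of ODD valuation (★ `odd_log_valued_of_galAdicCompletionMap_eq_neg`), and `log v_w(η) = −1`.
[cite: Jacobowitz1962, §5] [cite: SerreLocalFields1979, Ch. IV §2 Prop. 5] -/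
theorem even_log_valued_of_galAdicCompletionMap_eq (he : v.asIdeal.ramificationIdx' w.1.asIdeal ≠ 1) (h2 : Valued.v (2 : w.1.adicCompletion L) = 1)
    (η : (w.1.adicCompletion L)ˣ) (hη : Valued.v (η : w.1.adicCompletion L) = WithZero.exp (-1 : ℤ))
    (hση : galAdicCompletionMap (L := L) (IsCMField.complexConj L) hw (η : w.1.adicCompletion L) = -(η : w.1.adicCompletion L))
    {y : w.1.adicCompletion L} (hy0 : y ≠ 0) (hσy : galAdicCompletionMap (L := L) (IsCMField.complexConj L) hw y = y) :
    Even (WithZero.log (Valued.v y)) := by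
  have hc1 : IsCMField.complexConj L ≠ 1 := IsCMField.complexConj_ne_one L
  have hη0 : (η : w.1.adicCompletion L) ≠ 0 := Units.ne_zero η
  have hodd : Odd (WithZero.log (Valued.v (y * (η : w.1.adicCompletion L)))) :=
    odd_log_valued_of_galAdicCompletionMap_eq_neg L (IsCMField.complexConj L) hc1 w hw he h2 (mul_ne_zero hy0 hη0) (by rw [map_mul, hσy, hση, mul_neg])
  rw [map_mul, WithZero.log_mul ((Valuation.ne_zero_iff _).2 hy0) ((Valuation.ne_zero_iff _).2 hη0), hη, WithZero.log_exp] at hodd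
  obtain ⟨k, hk⟩ := hodd
  exact ⟨k + 1, by omega⟩

include hw in
/-- **Every `σ_w`-fixed `a ≠ 0` RESCALES TO A UNIT at a tamely ramified place**: `v(σ_w(c)·a·c) = 1` for `c = η^{j}`, `v_w(a) = exp(2j)` (§1; `v_w ∘ σ_w = v_w` ★
`valued_galAdicCompletionMap`) — the hypothesis `hsq` of ★ FILE C `exists_diagonal_formCongr_coe_eq_of_rescale`. [cite: Jacobowitz1962, §5, §8] -/
theorem exists_valuation_map_mul_mul_eq_one_of_galAdicCompletionMap_eq (he : v.asIdeal.ramificationIdx' w.1.asIdeal ≠ 1)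
    (h2 : Valued.v (2 : w.1.adicCompletion L) = 1)
    (η : (w.1.adicCompletion L)ˣ) (hη : Valued.v (η : w.1.adicCompletion L) = WithZero.exp (-1 : ℤ))
    (hση : galAdicCompletionMap (L := L) (IsCMField.complexConj L) hw (η : w.1.adicCompletion L) = -(η : w.1.adicCompletion L))
    {a : w.1.adicCompletion L} (ha0 : a ≠ 0) (hσa : galAdicCompletionMap (L := L) (IsCMField.complexConj L) hw a = a) :
    ∃ c : w.1.adicCompletion L, valuation (w.1.adicCompletion L) (galAdicCompletionMap (L := L) (IsCMField.complexConj L) hw c * a * c) = 1 := by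
  obtain ⟨j, hj⟩ := even_log_valued_of_galAdicCompletionMap_eq L v w hw he h2 η hη hση ha0 hσa
  have hη0 : (η : w.1.adicCompletion L) ≠ 0 := Units.ne_zero η
  have hva0 : Valued.v a ≠ 0 := (Valuation.ne_zero_iff _).2 ha0
  refine ⟨(η : w.1.adicCompletion L) ^ j, ?_⟩
  have hv : Valued.v (galAdicCompletionMap (L := L) (IsCMField.complexConj L) hw ((η : w.1.adicCompletion L) ^ j) * a * (η : w.1.adicCompletion L) ^ j) = 1 := by
    rw [map_mul, map_mul, valued_galAdicCompletionMap (L := L) (IsCMField.complexConj L) hw, map_zpow₀, hη, ← WithZero.exp_log hva0, hj, ← WithZero.exp_zsmul,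
      ← WithZero.exp_add, ← WithZero.exp_add, ← WithZero.exp_zero]
    congr 1
    simp only [smul_eq_mul]
    ring
  have h := (v_eq_iff_valuation_eq (galAdicCompletionMap (L := L) (IsCMField.complexConj L) hw ((η : w.1.adicCompletion L) ^ j) * a *
    (η : w.1.adicCompletion L) ^ j) (1 : w.1.adicCompletion L)).1 (by rw [hv, map_one])
  rwa [map_one] at h

/-! ## §2 The head: a compact element of `U((Φ₂)_w)` fixes a self-dual or an `η`-modular lattice -/

omit [IsCMField L] in
/-- `(Φ₂)_w = placeForm Φ₂ w` is the antidiagonal literal over `L_w` (★ `placeForm_antidiagOne`, `antidiagOne_eq_over`). [cite: Rogawski1990, §3.5 p. 29] -/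
private theorem placeForm_antidiagTwo_eq_literal' :
    placeForm (Matrix.of fun i j : Fin 2 => if i.val + j.val + 1 = 2 then (1 : L) else 0) w.1 =
      Matrix.of fun i j : Fin 2 => if i.val + j.val + 1 = 2 then (1 : w.1.adicCompletion L) else 0 := by
  rw [placeForm_antidiagOne, ← antidiagOne_eq_over]

omit [IsCMField L] in
/-- `(Φ₂)_w` as the `!![0, 1; 1, 0]` literal of ★ `HermitianLatticeTreeFlagTransitive` ∕ ★ `HermitianLatticeTreeTransitiveRamifiedFlags`. [cite: Rogawski1990, §3.5 p. 29] -/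
private theorem placeForm_antidiagTwo_eq_etaLiteral :
    placeForm (Matrix.of fun i j : Fin 2 => if i.val + j.val + 1 = 2 then (1 : L) else 0) w.1 = !![(0 : w.1.adicCompletion L), 1; 1, 0] := by
  rw [placeForm_antidiagTwo_eq_literal']
  ext i j
  fin_cases i <;> fin_cases j <;> simp [Matrix.of_apply]

omit [IsCMField L] in
/-- `|2|_w = 1` in `Valued` currency ⇒ `2 ∈ 𝒪_w^×` (the tame token of ★ `…SelfDualLocusRamifiedPlace` ∕ ★ A-p06's ramified transitivity). [cite: Jacobowitz1962, §8] -/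
private theorem isUnit_two_integer_of_valued_eq_one (h2 : Valued.v (2 : w.1.adicCompletion L) = 1) : IsUnit (2 : 𝒪[w.1.adicCompletion L]) := by
  refine (Valuation.integer.integers (valuation (w.1.adicCompletion L))).isUnit_iff_valuation_eq_one.mpr ?_
  have h := (v_eq_iff_valuation_eq (2 : w.1.adicCompletion L) 1).1 (by rw [h2, map_one])
  rw [map_one] at h
  rw [map_ofNat]
  exact h

include hw in
/-- **COMPACT ELEMENTS FIX A SPECIAL LATTICE AT A TAMELY RAMIFIED PLACE (I-5a-ram).**  `v` ramified (`e(w|v) ≠ 1`), non-split, tame (`|2|_w = 1`), `η` an anti-fixed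
uniformiser of `L_w`: every `γ ∈ U(σ_w, (Φ₂)_w)(L_w)` with INTEGRAL TRACE admits `g ∈ GL₂(L_w)`, `e ∈ {0,1}`, `J′ ∈ GL₂(𝒪_w)` with `η^e • ↑J′ = ᵗσ_w(g) (Φ₂)_w g`
(`e = 0`: `Λ(g)` self-dual, an EDGE midpoint of the tree of `U`; `e = 1`: `Λ(g)` `η`-modular, a VERTEX) and `g⁻¹ γ g ∈ GL₂(𝒪_w)`.  Trichotomy of `χ_γ` over `L_w`: distinct
roots of norm one ⇒ `e = 0` (★ FILE C §4 + §1: the elliptic torus fixes an edge midpoint [LabesseLanglands1979, p. 8]); split torus ⇒ `e = 0` (★ FILE A); double root ⇒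
`e = 0` (★ FILE C §3); no root ⇒ cyclic frame, `e ≡ ord_w(γ₁₀) (mod 2)` (★ FILE C §1–§2). [cite: Serre1980Trees, Ch. II §1.3] [cite: BruhatTits1972, §10] [cite: Jacobowitz1962, §8] -/
theorem exists_vertexFrame_of_trace_mem_of_ramified (he : v.asIdeal.ramificationIdx' w.1.asIdeal ≠ 1) (h2 : Valued.v (2 : w.1.adicCompletion L) = 1)
    (η : (w.1.adicCompletion L)ˣ) (hη : Valued.v (η : w.1.adicCompletion L) = WithZero.exp (-1 : ℤ))
    (hση : galAdicCompletionMap (L := L) (IsCMField.complexConj L) hw (η : w.1.adicCompletion L) = -(η : w.1.adicCompletion L))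
    (γ : GL (Fin 2) (w.1.adicCompletion L))
    (hγ : γ ∈ Literature.AlgebraicGeometry.ShimuraVarieties.unitaryGroup (galAdicCompletionMap (L := L) (IsCMField.complexConj L) hw)
      (placeForm (Matrix.of fun i j : Fin 2 => if i.val + j.val + 1 = 2 then (1 : L) else 0) w.1))
    (htr : ((γ : Matrix (Fin 2) (Fin 2) (w.1.adicCompletion L))).trace ∈ 𝒪[w.1.adicCompletion L]) :
    ∃ (g : GL (Fin 2) (w.1.adicCompletion L)) (e : ℕ), e ≤ 1 ∧
      (∃ J' ∈ glInt 2 (w.1.adicCompletion L),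
        (η : w.1.adicCompletion L) ^ e • (J' : Matrix (Fin 2) (Fin 2) (w.1.adicCompletion L)) =
          formCongr (galAdicCompletionMap (L := L) (IsCMField.complexConj L) hw) g
            (placeForm (Matrix.of fun i j : Fin 2 => if i.val + j.val + 1 = 2 then (1 : L) else 0) w.1)) ∧
      g⁻¹ * γ * g ∈ glInt 2 (w.1.adicCompletion L) := by
  classical
  have hc1 : IsCMField.complexConj L ≠ 1 := IsCMField.complexConj_ne_one L
  have hσσ : ∀ x, galAdicCompletionMap (L := L) (IsCMField.complexConj L) hw (galAdicCompletionMap (L := L) (IsCMField.complexConj L) hw x) = x :=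
    galAdicCompletionMap_galAdicCompletionMap_of_smul_eq (IsCMField.complexConj L) w hc1 hw
  have hη0 : (η : w.1.adicCompletion L) ≠ 0 := Units.ne_zero η
  have hηu : IsUniformizingElement (η : w.1.adicCompletion L) := isUniformizingElement_of_v_eq hη
  haveI : IsDiscreteValuationRing 𝒪[w.1.adicCompletion L] := isDiscreteValuationRing_integer_of_compatible hη
  have hση2 : galAdicCompletionMap (L := L) (IsCMField.complexConj L) hw ((η : w.1.adicCompletion L) * η) = (η : w.1.adicCompletion L) * η := by
    rw [map_mul, hση, neg_mul_neg]
  have hσv : ∀ x : w.1.adicCompletion L, valuation (w.1.adicCompletion L) (galAdicCompletionMap (L := L) (IsCMField.complexConj L) hw x) =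
      valuation (w.1.adicCompletion L) x := fun x => valuation_galAdicCompletionMap_eq (IsCMField.complexConj L) v w hw x
  have hunif : ∀ x : w.1.adicCompletion L, x ≠ 0 → ∃ k : ℤ, valuation (w.1.adicCompletion L) x = valuation (w.1.adicCompletion L) ((η : w.1.adicCompletion L) ^ k) :=
    fun x hx => exists_valuation_eq_valuation_zpow hηu hx
  have hJ := det_placeForm_antidiagTwo_ne_zero_and_even L v w
  have hdetv : valuation (w.1.adicCompletion L) (γ : Matrix (Fin 2) (Fin 2) (w.1.adicCompletion L)).det = 1 :=
    valuation_eq_one_of_galAdicCompletionMap_mul_self L v w hw (map_det_mul_det_eq_one_of_mem_unitaryGroup _ hJ.1 hγ)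
  have htrv : valuation (w.1.adicCompletion L) (γ : Matrix (Fin 2) (Fin 2) (w.1.adicCompletion L)).trace ≤ 1 := (Valuation.mem_integer_iff _ _).1 htr
  have hlit := placeForm_antidiagTwo_eq_literal' L v w
  have hsq : ∀ a : w.1.adicCompletion L, a ≠ 0 → galAdicCompletionMap (L := L) (IsCMField.complexConj L) hw a = a →
      ∃ c : w.1.adicCompletion L, valuation (w.1.adicCompletion L) (galAdicCompletionMap (L := L) (IsCMField.complexConj L) hw c * a * c) = 1 :=
    fun a ha0 hσa => exists_valuation_map_mul_mul_eq_one_of_galAdicCompletionMap_eq L v w hw he h2 η hη hση ha0 hσa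
  rcases em (∃ x : w.1.adicCompletion L, ((γ : Matrix (Fin 2) (Fin 2) (w.1.adicCompletion L)).charpoly).IsRoot x) with ⟨α, hα⟩ | hroot
  · rcases em ((γ : Matrix (Fin 2) (Fin 2) (w.1.adicCompletion L)).charpoly.Separable) with hsep | hsep
    · -- DISTINCT roots: an eigenframe with unit eigenvalues
      obtain ⟨P, u, hP, hu, -⟩ := exists_eigenframe_of_isRoot_of_separable γ hα hsep
      have huv : ∀ i, valuation (w.1.adicCompletion L) (u i) = 1 := valuation_eq_one_of_eigenframe P hP htrv hdetv
      rcases eq_or_ne (galAdicCompletionMap (L := L) (IsCMField.complexConj L) hw (u 0) * u 0) 1 with hN | hN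
      · -- type (1) elliptic: at a ramified place ALWAYS `e = 0` (unit-diagonal Gram after rescaling by `η^{−j}`)
        have hu1 : ∀ i, galAdicCompletionMap (L := L) (IsCMField.complexConj L) hw (u i) * u i = 1 :=
          Fin.forall_fin_two.2 ⟨hN, (map_mul_self_eq_one_iff_of_eigenframe _ (isUnit_iff_ne_zero.2 hJ.1) hγ hP).1 hN⟩
        obtain ⟨D, c, hD, J', hJ', hJ'e⟩ := exists_diagonal_formCongr_coe_eq_of_rescale _ hσσ (placeForm_antidiagTwo_hermitian L v w hw) hJ.1 hγ hP hu hu1 hsq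
        refine ⟨P * D, 0, zero_le_one, ⟨J', hJ', by rw [pow_zero, one_smul, hJ'e]⟩, ?_⟩
        exact mem_glInt_of_coe_eq_diagonal_of_valuation_eq_one (inv_mul_mul_eq_diagonal_of_eigenframe γ P D hP hD) huv
      · -- split torus: Gram `Φ₂` itself, `e = 0` (★ FILE A, place-generic)
        obtain ⟨g, hg, hgi⟩ := exists_formCongr_eq_antidiag_and_mem_glInt_of_not_normOne _ hσσ (placeForm_antidiagTwo_hermitian L v w hw) hJ.1 hγ hP hu hN huv
        obtain ⟨J', hJ', hJ'e⟩ := exists_mem_glInt_coe_eq_antidiag (K := w.1.adicCompletion L)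
        exact ⟨g, 0, zero_le_one, ⟨J', hJ', by rw [pow_zero, one_smul, hJ'e, hg]⟩, hgi⟩
    · -- DOUBLE root: scalar or unitary transvection, `e = 0` (★ FILE C §3, rescaling by `(ηη)^k`)
      rw [hlit] at hγ
      obtain ⟨g, hg, hgi⟩ := exists_formCongr_eq_and_mem_glInt_of_not_separable_of_map_mul_self _ hηu hσσ hση2 hγ hdetv hα hsep
      obtain ⟨J', hJ', hJ'e⟩ := exists_mem_glInt_coe_eq_antidiag (K := w.1.adicCompletion L)
      exact ⟨g, 0, zero_le_one, ⟨J', hJ', by rw [pow_zero, one_smul, hJ'e, hlit, hg]⟩, hgi⟩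
  · -- NO root: the rescaled cyclic frame (★ FILE C §1–§2), `antidiag(β, σβ) = η^e • ↑J′`
    rw [hlit] at hγ
    obtain ⟨P, β, e, -, he1, hcomp, hform, hval⟩ := exists_cyclicFrame_companion_antidiag_valuation _ hσσ hσv hη0 hunif γ hγ hroot
    obtain ⟨J', hJ', hJ'e⟩ := exists_mem_glInt_smul_coe_eq_antidiag_of_valuation_eq _ hσv hη0 hval
    refine ⟨P, e, he1, ⟨J', hJ', by rw [hJ'e, hlit, hform]⟩, ?_⟩
    exact mem_glInt_of_coe_eq_companion hcomp htr hdetv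

/-! ## §3 The two colours on the group carrier: `K = U ∩ GL₂(𝒪_w)` (edge) and `K♯ = U ∩ D_η GL₂(𝒪_w) D_η⁻¹` (vertex) -/

include hw in
/-- **COLOUR `e = 0` (SELF-DUAL = EDGE), group currency**: on `U = ↥U(σ_w, (Φ₂)_w)(L_w)` with `K := (glInt 2 L_w).subgroupOf U`, every `γ ∈ U` fixing a SELF-DUAL lattice
`Λ(g)` is `y k y⁻¹`, `y : U`, `k ∈ K` — at a TAMELY RAMIFIED place, via ★ `exists_mem_unitaryGroupOfForm_mul_of_selfDual_of_ramified` (`g = u k₀`).  Ramified twin of ★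
`exists_eq_mul_mul_inv_of_selfDual_antidiagTwo`. [cite: Jacobowitz1962, §8] [cite: Kottwitz1988, §2] -/
theorem exists_eq_mul_mul_inv_of_selfDual_antidiagTwo_of_ramified (he : v.asIdeal.ramificationIdx' w.1.asIdeal ≠ 1) (h2 : Valued.v (2 : w.1.adicCompletion L) = 1)
    (g : GL (Fin 2) (w.1.adicCompletion L))
    (hg : ∃ J' ∈ glInt 2 (w.1.adicCompletion L), (J' : Matrix (Fin 2) (Fin 2) (w.1.adicCompletion L)) =
      formCongr (galAdicCompletionMap (L := L) (IsCMField.complexConj L) hw) g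
        (placeForm (Matrix.of fun i j : Fin 2 => if i.val + j.val + 1 = 2 then (1 : L) else 0) w.1))
    (γ : ↥(Literature.AlgebraicGeometry.ShimuraVarieties.unitaryGroup (galAdicCompletionMap (L := L) (IsCMField.complexConj L) hw)
      (placeForm (Matrix.of fun i j : Fin 2 => if i.val + j.val + 1 = 2 then (1 : L) else 0) w.1)))
    (hγg : g⁻¹ * (γ : GL (Fin 2) (w.1.adicCompletion L)) * g ∈ glInt 2 (w.1.adicCompletion L)) :
    ∃ y : ↥(Literature.AlgebraicGeometry.ShimuraVarieties.unitaryGroup (galAdicCompletionMap (L := L) (IsCMField.complexConj L) hw)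
        (placeForm (Matrix.of fun i j : Fin 2 => if i.val + j.val + 1 = 2 then (1 : L) else 0) w.1)),
      ∃ k ∈ (glInt 2 (w.1.adicCompletion L)).subgroupOf
        (Literature.AlgebraicGeometry.ShimuraVarieties.unitaryGroup (galAdicCompletionMap (L := L) (IsCMField.complexConj L) hw)
          (placeForm (Matrix.of fun i j : Fin 2 => if i.val + j.val + 1 = 2 then (1 : L) else 0) w.1)),
      γ = y * k * y⁻¹ := by
  have hc1 : IsCMField.complexConj L ≠ 1 := IsCMField.complexConj_ne_one L
  have hJ := unit_placeForm_antidiagOne_mem_glInt (E := L) 2 w.1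
  have hcoe : (((isUnit_placeForm_antidiagOne (E := L) 2 w.1).unit : GL (Fin 2) (w.1.adicCompletion L)) :
      Matrix (Fin 2) (Fin 2) (w.1.adicCompletion L)) =
      placeForm (Matrix.of fun i j : Fin 2 => if i.val + j.val + 1 = 2 then (1 : L) else 0) w.1 := IsUnit.unit_spec _
  have hJh := placeForm_antidiagTwo_hermitian L v w hw
  rw [← hcoe] at hJh hg
  obtain ⟨u, hu, k, hk, rfl⟩ := exists_mem_unitaryGroupOfForm_mul_of_selfDual_of_ramified (IsCMField.complexConj L) w hc1 hw he
    (isUnit_two_integer_of_valued_eq_one L v w h2) _ hJ hJh g hg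
  have hu' : u ∈ Literature.AlgebraicGeometry.ShimuraVarieties.unitaryGroup (galAdicCompletionMap (L := L) (IsCMField.complexConj L) hw)
      (placeForm (Matrix.of fun i j : Fin 2 => if i.val + j.val + 1 = 2 then (1 : L) else 0) w.1) := hu
  refine ⟨⟨u, hu'⟩, ⟨u, hu'⟩⁻¹ * γ * ⟨u, hu'⟩, ?_, ?_⟩
  · rw [Subgroup.mem_subgroupOf]
    have h : u⁻¹ * (γ : GL (Fin 2) (w.1.adicCompletion L)) * u =
        k * ((u * k)⁻¹ * (γ : GL (Fin 2) (w.1.adicCompletion L)) * (u * k)) * k⁻¹ := by group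
    show u⁻¹ * (γ : GL (Fin 2) (w.1.adicCompletion L)) * u ∈ glInt 2 (w.1.adicCompletion L)
    rw [h]
    exact mul_mem (mul_mem hk hγg) (inv_mem hk)
  · group

include hw in
/-- **EVERY `η`-MODULAR LATTICE IS `u·Λ₁`, `u ∈ U`** (the by-product A-18 (a) for A-p01's R-2 ∕ B-p12's (U1)): at a tamely ramified place, for any uniformiser `η` of `L_w`,
`ᵗσ_w(g) (Φ₂)_w g ∈ η·GL₂(𝒪_w) ⇒ g = u · D_η · k`, `u ∈ U(σ_w, (Φ₂)_w)`, `D_η = diag(1, η)`, `k ∈ GL₂(𝒪_w)` — ★ A-p06 (hB) `forall_isModularLattice_exists_latt_mul_eq_of_ramified`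
(`latt g = latt (u D_η)`) + ★ `span_range_transpose_eq_iff`.  Ramified twin of ★ `exists_mem_unitaryGroupOfForm_mul_glDiagonal_mul_of_modular_antidiagTwo` (there `D_ϖ` is a
similitude; here `D_η` is not). [cite: BruhatTits1972, §10] [cite: Jacobowitz1962, §8] -/
theorem exists_mem_unitaryGroupOfForm_mul_glDiagonal_mul_of_modular_of_ramified (he : v.asIdeal.ramificationIdx' w.1.asIdeal ≠ 1)
    (h2 : Valued.v (2 : w.1.adicCompletion L) = 1)
    (η : (w.1.adicCompletion L)ˣ) (hη : Valued.v (η : w.1.adicCompletion L) = WithZero.exp (-1 : ℤ))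
    (g : GL (Fin 2) (w.1.adicCompletion L))
    (hg : ∃ J' ∈ glInt 2 (w.1.adicCompletion L), (η : w.1.adicCompletion L) • (J' : Matrix (Fin 2) (Fin 2) (w.1.adicCompletion L)) =
      formCongr (galAdicCompletionMap (L := L) (IsCMField.complexConj L) hw) g
        (placeForm (Matrix.of fun i j : Fin 2 => if i.val + j.val + 1 = 2 then (1 : L) else 0) w.1)) :
    ∃ u ∈ unitaryGroupOfForm (galAdicCompletionMap (L := L) (IsCMField.complexConj L) hw)
        (placeForm (Matrix.of fun i j : Fin 2 => if i.val + j.val + 1 = 2 then (1 : L) else 0) w.1),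
      ∃ k ∈ glInt 2 (w.1.adicCompletion L), g = u * glDiagonal 2 (w.1.adicCompletion L) ![1, η] * k := by
  have hc1 : IsCMField.complexConj L ≠ 1 := IsCMField.complexConj_ne_one L
  have hη0 : (η : w.1.adicCompletion L) ≠ 0 := Units.ne_zero η
  have hηu : IsUniformizingElement (η : w.1.adicCompletion L) := isUniformizingElement_of_v_eq hη
  haveI : IsDiscreteValuationRing 𝒪[w.1.adicCompletion L] := isDiscreteValuationRing_integer_of_compatible hη
  have hH2 := placeForm_antidiagTwo_eq_etaLiteral L v w
  have hd : ((glDiagonal 2 (w.1.adicCompletion L) ![1, η] : GL (Fin 2) (w.1.adicCompletion L)) : Matrix (Fin 2) (Fin 2) (w.1.adicCompletion L)) =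
      Matrix.diagonal ![(1 : w.1.adicCompletion L), (η : w.1.adicCompletion L)] := by
    rw [coe_glDiagonal]
    congr 1
    funext i
    fin_cases i <;> rfl
  -- `latt g` is `η`-modular for the literal form
  have hN : IsModularLattice (galAdicCompletionMap (L := L) (IsCMField.complexConj L) hw) (η : w.1.adicCompletion L)
      (!![(0 : w.1.adicCompletion L), 1; 1, 0]) (latt (g : Matrix (Fin 2) (Fin 2) (w.1.adicCompletion L))) := by
    refine ⟨g, rfl, (isUnimodular₂_inv_smul_iff_exists_mem_glInt hη0 _).2 ?_⟩
    rw [← hH2]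
    exact hg
  obtain ⟨u, hu⟩ := forall_isModularLattice_exists_latt_mul_eq_of_ramified (IsCMField.complexConj L) w hc1 hw he (isUnit_two_integer_of_valued_eq_one L v w h2)
    hηu hd _ hN
  have hk : ((u : GL (Fin 2) (w.1.adicCompletion L)) * glDiagonal 2 (w.1.adicCompletion L) ![1, η])⁻¹ * g ∈ glInt 2 (w.1.adicCompletion L) :=
    (span_range_transpose_eq_iff _ _).1 hu
  have hu' : (u : GL (Fin 2) (w.1.adicCompletion L)) ∈ unitaryGroupOfForm (galAdicCompletionMap (L := L) (IsCMField.complexConj L) hw)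
      (placeForm (Matrix.of fun i j : Fin 2 => if i.val + j.val + 1 = 2 then (1 : L) else 0) w.1) := by
    rw [hH2]; exact u.2
  exact ⟨u, hu', _, hk, by rw [mul_inv_cancel_left]⟩

include hw in
/-- **COLOUR `e = 1` (`η`-MODULAR = VERTEX), group currency**: with `K♯ := ((GL₂(𝒪_w)).map (conj D_η)).subgroupOf U`, `D_η = glDiagonal 2 L_w ![1, η]`, every `γ ∈ U` fixing an
`η`-modular lattice `Λ(g)` is `y k y⁻¹`, `y : U`, `k ∈ K♯`.  Ramified twin of ★ `exists_eq_mul_mul_inv_of_modular_antidiagTwo`. [cite: BruhatTits1972, §10] [cite: Kottwitz1988, §2] -/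
theorem exists_eq_mul_mul_inv_of_modular_antidiagTwo_of_ramified (he : v.asIdeal.ramificationIdx' w.1.asIdeal ≠ 1) (h2 : Valued.v (2 : w.1.adicCompletion L) = 1)
    (η : (w.1.adicCompletion L)ˣ) (hη : Valued.v (η : w.1.adicCompletion L) = WithZero.exp (-1 : ℤ))
    (g : GL (Fin 2) (w.1.adicCompletion L))
    (hg : ∃ J' ∈ glInt 2 (w.1.adicCompletion L), (η : w.1.adicCompletion L) • (J' : Matrix (Fin 2) (Fin 2) (w.1.adicCompletion L)) =
      formCongr (galAdicCompletionMap (L := L) (IsCMField.complexConj L) hw) g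
        (placeForm (Matrix.of fun i j : Fin 2 => if i.val + j.val + 1 = 2 then (1 : L) else 0) w.1))
    (γ : ↥(Literature.AlgebraicGeometry.ShimuraVarieties.unitaryGroup (galAdicCompletionMap (L := L) (IsCMField.complexConj L) hw)
      (placeForm (Matrix.of fun i j : Fin 2 => if i.val + j.val + 1 = 2 then (1 : L) else 0) w.1)))
    (hγg : g⁻¹ * (γ : GL (Fin 2) (w.1.adicCompletion L)) * g ∈ glInt 2 (w.1.adicCompletion L)) :
    ∃ y : ↥(Literature.AlgebraicGeometry.ShimuraVarieties.unitaryGroup (galAdicCompletionMap (L := L) (IsCMField.complexConj L) hw)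
        (placeForm (Matrix.of fun i j : Fin 2 => if i.val + j.val + 1 = 2 then (1 : L) else 0) w.1)),
      ∃ k ∈ ((glInt 2 (w.1.adicCompletion L)).map (MulAut.conj (glDiagonal 2 (w.1.adicCompletion L) ![1, η])).toMonoidHom).subgroupOf
        (Literature.AlgebraicGeometry.ShimuraVarieties.unitaryGroup (galAdicCompletionMap (L := L) (IsCMField.complexConj L) hw)
          (placeForm (Matrix.of fun i j : Fin 2 => if i.val + j.val + 1 = 2 then (1 : L) else 0) w.1)),
      γ = y * k * y⁻¹ := by
  obtain ⟨u, hu, k, hk, hgk⟩ := exists_mem_unitaryGroupOfForm_mul_glDiagonal_mul_of_modular_of_ramified L v w hw he h2 η hη g hg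
  have hu' : u ∈ Literature.AlgebraicGeometry.ShimuraVarieties.unitaryGroup (galAdicCompletionMap (L := L) (IsCMField.complexConj L) hw)
      (placeForm (Matrix.of fun i j : Fin 2 => if i.val + j.val + 1 = 2 then (1 : L) else 0) w.1) := hu
  refine ⟨⟨u, hu'⟩, ⟨u, hu'⟩⁻¹ * γ * ⟨u, hu'⟩, ?_, ?_⟩
  · rw [Subgroup.mem_subgroupOf]
    show u⁻¹ * (γ : GL (Fin 2) (w.1.adicCompletion L)) * u ∈
      (glInt 2 (w.1.adicCompletion L)).map (MulAut.conj (glDiagonal 2 (w.1.adicCompletion L) ![1, η])).toMonoidHom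
    rw [Subgroup.mem_map_equiv, MulAut.conj_symm_apply]
    have h : (glDiagonal 2 (w.1.adicCompletion L) ![1, η])⁻¹ * (u⁻¹ * (γ : GL (Fin 2) (w.1.adicCompletion L)) * u) *
        glDiagonal 2 (w.1.adicCompletion L) ![1, η] =
        k * ((u * glDiagonal 2 (w.1.adicCompletion L) ![1, η] * k)⁻¹ * (γ : GL (Fin 2) (w.1.adicCompletion L)) *
          (u * glDiagonal 2 (w.1.adicCompletion L) ![1, η] * k)) * k⁻¹ := by group
    rw [h, ← hgk]
    exact mul_mem (mul_mem hk hγg) (inv_mem hk)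
  · group

/-! ## §4 The cover: `{γ ∈ U | tr γ ∈ 𝒪_w} ⊆ ⋃_y y K y⁻¹ ∪ ⋃_y y K♯ y⁻¹` -/

include hw in
/-- **SUPPORT LOCALISATION ON `U = ↥U(σ_w, (Φ₂)_w)(L_w)` AT A TAMELY RAMIFIED PLACE (I-5a-ram, A-16 (b))**: `{γ ∈ U | tr γ ∈ 𝒪_w} ⊆ ⋃_y y K y⁻¹ ∪ ⋃_y y K♯ y⁻¹` with
`K := GL₂(𝒪_w) ⊓ U` (stabiliser of the self-dual `𝒪_w²`, an EDGE of the tree of `U`) and `K♯ := (D_η GL₂(𝒪_w) D_η⁻¹) ⊓ U`, `D_η = diag(1, η)` (stabiliser of the `η`-modular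
`𝒪 ⊕ η𝒪`, a VERTEX).  Ramified sibling of ★ `exists_eq_mul_mul_inv_or_of_trace_mem`; the input `hcov` of the architect's `exists_vertexCover` at ramified `w`.
[cite: BruhatTits1972, §10] [cite: Serre1980Trees, Ch. II §1.3] [cite: Rogawski1990, §4.9 Lemma 4.9.3 p. 56] -/
theorem exists_eq_mul_mul_inv_or_of_trace_mem_of_ramified (he : v.asIdeal.ramificationIdx' w.1.asIdeal ≠ 1) (h2 : Valued.v (2 : w.1.adicCompletion L) = 1)
    (η : (w.1.adicCompletion L)ˣ) (hη : Valued.v (η : w.1.adicCompletion L) = WithZero.exp (-1 : ℤ))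
    (hση : galAdicCompletionMap (L := L) (IsCMField.complexConj L) hw (η : w.1.adicCompletion L) = -(η : w.1.adicCompletion L))
    (γ : ↥(Literature.AlgebraicGeometry.ShimuraVarieties.unitaryGroup (galAdicCompletionMap (L := L) (IsCMField.complexConj L) hw)
      (placeForm (Matrix.of fun i j : Fin 2 => if i.val + j.val + 1 = 2 then (1 : L) else 0) w.1)))
    (htr : (((γ : GL (Fin 2) (w.1.adicCompletion L)) : Matrix (Fin 2) (Fin 2) (w.1.adicCompletion L))).trace ∈ 𝒪[w.1.adicCompletion L]) :
    (∃ y : ↥(Literature.AlgebraicGeometry.ShimuraVarieties.unitaryGroup (galAdicCompletionMap (L := L) (IsCMField.complexConj L) hw)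
        (placeForm (Matrix.of fun i j : Fin 2 => if i.val + j.val + 1 = 2 then (1 : L) else 0) w.1)),
      ∃ k ∈ (glInt 2 (w.1.adicCompletion L)).subgroupOf
        (Literature.AlgebraicGeometry.ShimuraVarieties.unitaryGroup (galAdicCompletionMap (L := L) (IsCMField.complexConj L) hw)
          (placeForm (Matrix.of fun i j : Fin 2 => if i.val + j.val + 1 = 2 then (1 : L) else 0) w.1)),
      γ = y * k * y⁻¹) ∨
    (∃ y : ↥(Literature.AlgebraicGeometry.ShimuraVarieties.unitaryGroup (galAdicCompletionMap (L := L) (IsCMField.complexConj L) hw)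
        (placeForm (Matrix.of fun i j : Fin 2 => if i.val + j.val + 1 = 2 then (1 : L) else 0) w.1)),
      ∃ k ∈ ((glInt 2 (w.1.adicCompletion L)).map (MulAut.conj (glDiagonal 2 (w.1.adicCompletion L) ![1, η])).toMonoidHom).subgroupOf
        (Literature.AlgebraicGeometry.ShimuraVarieties.unitaryGroup (galAdicCompletionMap (L := L) (IsCMField.complexConj L) hw)
          (placeForm (Matrix.of fun i j : Fin 2 => if i.val + j.val + 1 = 2 then (1 : L) else 0) w.1)),
      γ = y * k * y⁻¹) := by
  obtain ⟨g, e, he1, ⟨J', hJ', hJ'e⟩, hγg⟩ := exists_vertexFrame_of_trace_mem_of_ramified L v w hw he h2 η hη hση γ γ.2 htr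
  rcases Nat.le_one_iff_eq_zero_or_eq_one.1 he1 with rfl | rfl
  · left
    exact exists_eq_mul_mul_inv_of_selfDual_antidiagTwo_of_ramified L v w hw he h2 g ⟨J', hJ', by rw [← hJ'e, pow_zero, one_smul]⟩ γ hγg
  · right
    exact exists_eq_mul_mul_inv_of_modular_antidiagTwo_of_ramified L v w hw he h2 η hη g ⟨J', hJ', by rw [← hJ'e, pow_one]⟩ γ hγg

end CM

end UnitaryGroup

end Literature.NumberTheory.Automorphic

end
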